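import Summits.CriticalPhenomena.CardyFormulaZ2.Theorems.CardySelfRefinementLagHandOffTranslation
import Summits.CriticalPhenomena.CardyFormulaZ2.Theorems.CardySelfRefinementRotationInput
import Mathlib.Analysis.Normed.Affine.MazurUlam
import Mathlib.Analysis.Complex.Isometry
import HarnessLib

/-!
# Stub S2 `stub_isometryOfRotation` of crux `Z2LimitsSymmetric` (stmt-CriticalPhenomena-14827)

Route `CardyMeckeFlip`, sub-problem `CardyFormulaZ2`, line `registered`
(`Cruxes/Z2LimitsSymmetric/Lines/birth.lean`), stub S2: for a subsequential quad-crossing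
scaling limit `μ ∈ Λ = subseqQuadLimits univ` of critical bond percolation on `δℤ²` (a law on the
Schramm–Smirnov space `ℋ_ℂ = QuadConfig univ`), invariance under all rotations about the origin
(the hypothesis; DKKMO's theorem, stub S1) upgrades to invariance under EVERY Euclidean isometry
`g : ℂ ≃ᵢ ℂ`: `μ ∘ (g·)⁻¹ = μ`.

Proof.
* Translations: `μ ∘ T_w⁻¹ = μ` for every `w ∈ ℂ` is the tree theorem
  `Cruxes.LagHandOff.CrosscutDictionary.stub_translationInput`
  (`Theorems/CardySelfRefinementLagHandOffTranslation.lean`).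
* The reflection `z ↦ z̄` (`map_conj_eq_of_mem_subseqQuadLimits`): along the defining meshes
  `δₖ → 0⁺` of `μ` (`isSubseqQuadLimit_iff`) the lattice laws are EXACTLY reflection invariant
  (`z2QuadLaw_map_conj`), the push-forward along the homeomorphism `S ↦ S̄` of `ℋ_ℂ` is weakly
  continuous (`FiniteMeasure.tendsto_map_of_tendsto_of_continuous`), and weak limits of finite
  Borel measures on the metrisable `ℋ_ℂ` are unique (`QuadConfig.hasOuterApproxClosed`).
* Every isometry: by Mazur–Ulam (`IsometryEquiv.toRealLinearIsometryEquiv`) `z ↦ g z - g 0` is a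
  real-linear isometry of `ℂ`, hence `z ↦ a z` or `z ↦ a z̄` with `|a| = 1`
  (`linear_isometry_complex`), and `a = e^{iα}` with `α = arg a` (`Circle.exp_arg`).  So the
  motion `S ↦ g · S` of `ℋ_ℂ` factors as `T_{g 0} ∘ R_α` or `T_{g 0} ∘ R_α ∘ conj`
  (`QuadConfig.mapHomeomorph_trans`), and `Measure.map_map` with the three invariances concludes.

References: O. Schramm, S. Smirnov, Ann. Probab. 39 (2011), §1.3–1.4; H. Duminil-Copin,
K. K. Kozlowski, D. Krachun, I. Manolescu, M. Oulamara, arXiv:2012.11672, Thm. 1.2.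
-/

noncomputable section

open MeasureTheory Filter Set Topology
open Literature.Probability.Percolation Literature.Probability.Percolation.QuadCrossing

namespace Summit.CriticalPhenomena.CardyFormulaZ2.Cruxes.Z2LimitsSymmetric

/-! ### Reflection invariance of subsequential limits -/

/-- **Reflection invariance of subsequential scaling limits.**  Every `μ ∈ Λ = subseqQuadLimits univ`
is invariant under complex conjugation of configurations, `μ ∘ conj⁻¹ = μ`: along the defining
meshes `δₖ → 0⁺` (`isSubseqQuadLimit_iff`), `μ_{δₖ} ∘ conj⁻¹ = μ_{δₖ}` exactly
(`z2QuadLaw_map_conj`, the reflection of `δℤ²` in the real axis), `μ_{δₖ} ∘ conj⁻¹ → μ ∘ conj⁻¹`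
by continuity of the push-forward along the homeomorphism `conj` of `ℋ_ℂ`, and weak limits on the
metrisable `ℋ_ℂ` are unique (`QuadConfig.hasOuterApproxClosed`). -/
theorem map_conj_eq_of_mem_subseqQuadLimits {μ : FiniteMeasure (QuadConfig (univ : Set ℂ))}
    (hμ : μ ∈ subseqQuadLimits (univ : Set ℂ)) : μ.map QuadConfig.conj = μ := by
  obtain ⟨δs, -, -, hlim⟩ := (isSubseqQuadLimit_iff univ μ).mp hμ
  haveI : HasOuterApproxClosed (QuadConfig (univ : Set ℂ)) :=
    QuadConfig.hasOuterApproxClosed isOpen_univ univ_nonempty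
  have h1 : Tendsto (fun n => (z2QuadLaw univ (δs n)).map QuadConfig.conj) atTop
      (𝓝 (μ.map QuadConfig.conj)) :=
    FiniteMeasure.tendsto_map_of_tendsto_of_continuous _ _ hlim
      (QuadConfig.continuous_mapHomeomorph _)
  exact tendsto_nhds_unique h1 (hlim.congr fun n => (z2QuadLaw_map_conj (δs n)).symm)

/-! ### The three invariances, on the underlying measures -/

/-- Translation invariance of `μ ∈ Λ` on the underlying measure: `μ ∘ T_w⁻¹ = μ`
(`stub_translationInput`, tree). -/
theorem toMeasure_map_translate_eq_of_mem_subseqQuadLimits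
    {μ : FiniteMeasure (QuadConfig (univ : Set ℂ))} (hμ : μ ∈ subseqQuadLimits (univ : Set ℂ))
    (w : ℂ) :
    (μ : Measure (QuadConfig (univ : Set ℂ))).map (QuadConfig.translate w) = μ := by
  rw [← FiniteMeasure.toMeasure_map,
    Summit.CriticalPhenomena.CardyFormulaZ2.Cruxes.LagHandOff.CrosscutDictionary.stub_translationInput
      μ hμ w]

/-- Reflection invariance of `μ ∈ Λ` on the underlying measure: `μ ∘ conj⁻¹ = μ`
(`map_conj_eq_of_mem_subseqQuadLimits`). -/
theorem toMeasure_map_conj_eq_of_mem_subseqQuadLimits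
    {μ : FiniteMeasure (QuadConfig (univ : Set ℂ))} (hμ : μ ∈ subseqQuadLimits (univ : Set ℂ)) :
    (μ : Measure (QuadConfig (univ : Set ℂ))).map QuadConfig.conj = μ := by
  rw [← FiniteMeasure.toMeasure_map, map_conj_eq_of_mem_subseqQuadLimits hμ]

/-- Rotation invariance in `isometryLaw` form gives `μ ∘ R_α⁻¹ = μ` on the underlying measure
(`isometryLaw (rotation e^{iα}) μ = μ.map (rotate α)`). -/
theorem toMeasure_map_rotate_eq_of_forall_isometryLaw
    {μ : FiniteMeasure (QuadConfig (univ : Set ℂ))}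
    (hrot : ∀ α : ℝ, isometryLaw (rotation (Circle.exp α)).toIsometryEquiv μ = μ) (α : ℝ) :
    (μ : Measure (QuadConfig (univ : Set ℂ))).map (QuadConfig.rotate α) = μ := by
  rw [← FiniteMeasure.toMeasure_map,
    ← Summit.CriticalPhenomena.CardyFormulaZ2.Theorems.isometryLaw_rotation_eq_map_rotate, hrot α]

/-! ### Factorisation of the motion of `ℋ_ℂ` by a Euclidean isometry -/

/-- **Orientation-preserving case.**  If `g z = a z + g 0` with `a` on the unit circle, the motion
`S ↦ g · S` of `ℋ_ℂ` is the rotation by `arg a` followed by the translation by `g 0`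
(`g = T_{g 0} ∘ (e^{i arg a} ·)` as plane homeomorphisms, `Circle.exp_arg`, and the action law
`QuadConfig.mapHomeomorph_trans`). -/
theorem isometry_eq_translate_comp_rotate (g : ℂ ≃ᵢ ℂ) (a : Circle)
    (h : ∀ z : ℂ, g z = a * z + g 0) :
    QuadConfig.isometry g =
      QuadConfig.translate (g 0) ∘ QuadConfig.rotate (Complex.arg (a : ℂ)) := by
  have hg : g.toHomeomorph =
      ((rotation (Circle.exp (Complex.arg (a : ℂ)))).toHomeomorph).trans
        (Homeomorph.addLeft (g 0)) := by
    refine Homeomorph.ext fun z => ?_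
    rw [Circle.exp_arg, Homeomorph.trans_apply, Homeomorph.coe_addLeft,
      LinearIsometryEquiv.coe_toHomeomorph, rotation_apply, IsometryEquiv.coe_toHomeomorph, h z,
      add_comm]
  funext S
  show S.mapHomeomorph g.toHomeomorph = (S.mapHomeomorph _).mapHomeomorph _
  rw [hg, QuadConfig.mapHomeomorph_trans]

/-- **Orientation-reversing case.**  If `g z = a z̄ + g 0` with `a` on the unit circle, the motion
`S ↦ g · S` of `ℋ_ℂ` is complex conjugation followed by the rotation by `arg a` followed by the
translation by `g 0`. -/
theorem isometry_eq_translate_comp_rotate_comp_conj (g : ℂ ≃ᵢ ℂ) (a : Circle)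
    (h : ∀ z : ℂ, g z = a * (starRingEnd ℂ) z + g 0) :
    QuadConfig.isometry g =
      QuadConfig.translate (g 0) ∘ QuadConfig.rotate (Complex.arg (a : ℂ)) ∘ QuadConfig.conj := by
  have hg : g.toHomeomorph =
      (Complex.conjCLE.toHomeomorph.trans
        (rotation (Circle.exp (Complex.arg (a : ℂ)))).toHomeomorph).trans
          (Homeomorph.addLeft (g 0)) := by
    refine Homeomorph.ext fun z => ?_
    rw [Circle.exp_arg, Homeomorph.trans_apply, Homeomorph.trans_apply, Homeomorph.coe_addLeft,
      LinearIsometryEquiv.coe_toHomeomorph, rotation_apply, ContinuousLinearEquiv.coe_toHomeomorph,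
      Complex.conjCLE_apply, IsometryEquiv.coe_toHomeomorph, h z, add_comm]
  funext S
  show S.mapHomeomorph g.toHomeomorph = ((S.mapHomeomorph _).mapHomeomorph _).mapHomeomorph _
  rw [hg, QuadConfig.mapHomeomorph_trans, QuadConfig.mapHomeomorph_trans]

/-! ### The stub -/

/-- **S2 — `stub_isometryOfRotation`: for `ℤ²` sublimits, rotation invariance upgrades to full
`E(2)` invariance.**  For `μ ∈ Λ = subseqQuadLimits univ` invariant under every rotation
`z ↦ e^{iα} z` (`isometryLaw (rotation e^{iα}) μ = μ`), and every isometry `g` of `ℂ`,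
`μ ∘ (g·)⁻¹ = μ` on `ℋ_ℂ`.  Translations: `stub_translationInput` (tree); the reflection
`z ↦ z̄`: `map_conj_eq_of_mem_subseqQuadLimits` (exact lattice symmetry `z2QuadLaw_map_conj` +
continuity of the push-forward + uniqueness of weak limits); generation: by Mazur–Ulam
(`IsometryEquiv.toRealLinearIsometryEquiv`) and `linear_isometry_complex`, `g z = a z + g 0` or
`g z = a z̄ + g 0` with `|a| = 1`, `a = e^{i arg a}`, so `g· = T_{g 0} ∘ R_{arg a} (∘ conj)` on `ℋ_ℂ`
(`isometry_eq_translate_comp_rotate`, `isometry_eq_translate_comp_rotate_comp_conj`), and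
`Measure.map_map`. -/
theorem stub_isometryOfRotation : open Literature.Probability.Percolation.QuadCrossing in ∀ μ ∈ subseqQuadLimits (Set.univ : Set ℂ), (∀ α : ℝ, isometryLaw (rotation (Circle.exp α)).toIsometryEquiv μ = μ) → ∀ g : ℂ ≃ᵢ ℂ, MeasureTheory.Measure.map (QuadConfig.isometry g) ((μ : MeasureTheory.FiniteMeasure (QuadConfig (Set.univ : Set ℂ))) : MeasureTheory.Measure (QuadConfig (Set.univ : Set ℂ))) = ((μ : MeasureTheory.FiniteMeasure (QuadConfig (Set.univ : Set ℂ))) : MeasureTheory.Measure (QuadConfig (Set.univ : Set ℂ))) := by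
  intro μ hμ hrot g
  -- Mazur–Ulam: `z ↦ g z - g 0` is a real-linear isometry of `ℂ`, hence `a z` or `a z̄`, `|a| = 1`
  have hdec : ∀ z : ℂ, g z = g.toRealLinearIsometryEquiv z + g 0 := fun z => by
    rw [IsometryEquiv.toRealLinearIsometryEquiv_apply, sub_add_cancel]
  obtain ⟨a, ha | ha⟩ := linear_isometry_complex g.toRealLinearIsometryEquiv
  · -- `g z = a z + g 0`: a rotation followed by a translation
    have h : ∀ z : ℂ, g z = a * z + g 0 := fun z => by rw [hdec z, ha, rotation_apply]
    rw [isometry_eq_translate_comp_rotate g a h,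
      ← Measure.map_map (QuadConfig.measurable_translate _) (QuadConfig.measurable_rotate _),
      toMeasure_map_rotate_eq_of_forall_isometryLaw hrot,
      toMeasure_map_translate_eq_of_mem_subseqQuadLimits hμ]
  · -- `g z = a z̄ + g 0`: conjugation, then a rotation, then a translation
    have h : ∀ z : ℂ, g z = a * (starRingEnd ℂ) z + g 0 := fun z => by
      rw [hdec z, ha, LinearIsometryEquiv.trans_apply, rotation_apply, Complex.conjLIE_apply]
    rw [isometry_eq_translate_comp_rotate_comp_conj g a h,
      ← Measure.map_map (QuadConfig.measurable_translate _)
        ((QuadConfig.measurable_rotate _).comp QuadConfig.measurable_conj),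
      ← Measure.map_map (QuadConfig.measurable_rotate _) QuadConfig.measurable_conj,
      toMeasure_map_conj_eq_of_mem_subseqQuadLimits hμ,
      toMeasure_map_rotate_eq_of_forall_isometryLaw hrot,
      toMeasure_map_translate_eq_of_mem_subseqQuadLimits hμ]

end Summit.CriticalPhenomena.CardyFormulaZ2.Cruxes.Z2LimitsSymmetric

end
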